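import Summits.CriticalPhenomena.PercolationContinuityZ3.Theorems.PercNearOneGluingNoHeavyQuantFarSunLargeKLinear
import HarnessLib

/-!
# FAR beyond trees: `Quant.FarRelayRow`'s body at EVERY layer `j ≥ 2` on every RING and every hairy cycle with `K ≥ 1600·j + 81` relays

builds on p205010 (kernel theorem, internal audit signed; external expert review pending)

Support file (`--supports stmt-CriticalPhenomena-4575`), seat `prim-cert-1` (gen 41); memo `prim-cert-1/FROM-prim-cert-1-g41-ALL-LAYERS.md` §0(iv), §3.
The measure-level (graph) forms of `HairyCycle.sunFAR_of_ge_linear` (…QuantFarSunLargeKLinear) through the bridges of …QuantFarSunRow: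
* **`HairyCycle.farRelayRow_hairyCycle_of_ge_linear`** — on every hairy cycle `IsHairyCycle L cyc K base tip` (pendant relays), `j ≥ 2`, `1600j + 81 ≤ K`;
* **`HairyCycle.farRelayRow_ring_of_ge_linear`** — on every ring `IsHairyCycleD L cyc K base tip` (relay `k` = the cycle vertex `c_{b_k}` or a pendant tip attached
  to it; weights supported on the cycle edges and the proper hair edges), `j ≥ 2`, `1600j + 81 ≤ K`:
  `2j < Σ_a P(o ↔ a)` and `P(o ↮ a) ≤ t` on the relays imply `P(#{a : o ↔ a} ≤ j) ≤ t` — verbatim the body of `Quant.FarRelayRow`.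
With layers `0, 1, 2` known for all `K` (…TKFinalAllK, …LayerTwo) and `K ≤ 10` (`…RowLeTen`) at every layer, FAR on rings/hairy cycles is now open only for
`11 ≤ K ≤ 1600j + 80` at layers `j ≥ 3` (and `K = 11` closes with …RowLeEleven).  No definitions, no sorries, standard axioms.  [this work]
[cite: KozmaNitzan2024, Lemma 2 (p. 6), Conjecture 3 (p. 15)] (context: the lower-tail family FAR serves).
-/

noncomputable section

namespace Summit.CriticalPhenomena.PercolationContinuityZ3.Theorems.HairyCycle

open Finset MeasureTheory
open Literature.Probability.Percolation Literature.Probability.LatticeModels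
open Summit.CriticalPhenomena.PercolationContinuityZ3.Theorems.TwoCopy
open scoped Classical

/-- **FAR at every layer `j ≥ 2` on every hairy cycle with `K ≥ 1600j + 81` pendant relays**, all weights. [this work] -/
theorem farRelayRow_hairyCycle_of_ge_linear {n L K : ℕ} {cyc : ℕ → Fin n} {base : ℕ → ℕ} {tip : ℕ → Fin n} (H : IsHairyCycle L cyc K base tip)
    {j : ℕ} (hj : 2 ≤ j) (hK : 1600 * j + 81 ≤ K) (w : Sym2 (Fin n) → unitInterval)
    (hsupp : ∀ e : Sym2 (Fin n), ¬ e.IsDiag → w e ≠ 0 →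
      (∃ i, i < L ∧ e = cycE L cyc i) ∨ (∃ k, k < K ∧ e = hairE cyc base tip k))
    (t : ℝ)
    (hEN : (2 * j : ℝ) < ∑ a ∈ (Finset.range K).image tip, (prodBernoulli w).real (openConn (cyc 0) a))
    (hcut : ∀ a ∈ (Finset.range K).image tip, (prodBernoulli w).real (openConn (cyc 0) a)ᶜ ≤ t) :
    (prodBernoulli w).real {ω : BondConfig (Fin n) |
      (((Finset.range K).image tip).filter fun a => ω ∈ openConn (cyc 0) a).card ≤ j} ≤ t :=
  farRelayRow_hairyCycle_of_sunFAR H (sunFAR_of_ge_linear hj hK) w hsupp t hEN hcut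

/-- **FAR at every layer `j ≥ 2` on every RING with `K ≥ 1600j + 81` relays** (relays at cycle vertices and/or on pendant hairs), all weights
supported on the cycle and proper hair edges. [this work] -/
theorem farRelayRow_ring_of_ge_linear {n L K : ℕ} {cyc : ℕ → Fin n} {base : ℕ → ℕ} {tip : ℕ → Fin n} (H : IsHairyCycleD L cyc K base tip)
    {j : ℕ} (hj : 2 ≤ j) (hK : 1600 * j + 81 ≤ K) (w : Sym2 (Fin n) → unitInterval)
    (hsupp : ∀ e : Sym2 (Fin n), ¬ e.IsDiag → w e ≠ 0 →
      (∃ i, i < L ∧ e = cycE L cyc i) ∨ (∃ k, k < K ∧ e = hairE cyc base tip k))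
    (t : ℝ)
    (hEN : (2 * j : ℝ) < ∑ a ∈ (Finset.range K).image tip, (prodBernoulli w).real (openConn (cyc 0) a))
    (hcut : ∀ a ∈ (Finset.range K).image tip, (prodBernoulli w).real (openConn (cyc 0) a)ᶜ ≤ t) :
    (prodBernoulli w).real {ω : BondConfig (Fin n) |
      (((Finset.range K).image tip).filter fun a => ω ∈ openConn (cyc 0) a).card ≤ j} ≤ t :=
  farRelayRow_ring_of_sunFAR H (sunFAR_of_ge_linear hj hK) w hsupp t hEN hcut

end Summit.CriticalPhenomena.PercolationContinuityZ3.Theorems.HairyCycle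

end
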